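import Summits.QuantumFields.YangMills.Theorems.AlphaInputsT3ACv3StepLowMaxB3
import Literature.MathematicalPhysics.QuantumFieldTheory.Balaban1983to89.BlockAveragingEMLProp2
import Literature.MathematicalPhysics.QuantumFieldTheory.Balaban1983to89.LatticeWordStokes
import Literature.MathematicalPhysics.QuantumFieldTheory.Balaban1983to89.T3SmallLiftHistory
import Summits.QuantumFields.Balaban3D.Proofs.FibreClash
import HarnessLib

/-!
# `AlphaInputsT3ACDeepFibrePointOfRows` — THE DEEP FIBRE POINT OF PRINT'S χ: why [Balaban1985UV3] puts χ on the MINIMISER ((47) p.267), as a theorem of the rows record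
# (cell `ym3-torus`, row #23 `fibre57LowOn` residue `hcharge`, link (L1) of 19936 evidence «LOCATE-ALPHA-23-hcharge-supplier» (px20 g13) — the letter w8-19936 g16's
# (K-charge) knit consumes; seat `ym3-torus-px20` g13, width copy of p1; `--supports stmt-QuantumFields-19936 --as helper`)

WHAT.  For a version-agnostic rows record `q : AlphaInputsT3AC.PkgCoreRows F 𝔠 γ hγ hγ1 K`, a step `k + 1 ≤ K`, a window constant `c > 0` and a level-`(k+1)` field `V`
in the (4)-window (`|V(∂p) − 1| < ε₁(k+1)`) AND in print's minimiser window `chiMinAC 𝔠.lane q.X c (k+1)` (the finest minimiser `Ũ := U_{k+1}(V)` is `c·ε₁(k+1)·L^{−2(k+1)}`-small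
at every plaquette), the level-`k` field `U₀ := (blockAvg ℰp)^k Ũ` is a point of the one-step fibre of `V` DEEP INSIDE the level-`k` small-field region:
★ `AlphaInputsT3AC.PkgCoreRows.deepFibrePoint_of_rows`: `avgFun ℰp U₀ = V` ∧ `∀ c i, dist1 (loopHol U₀ c i) < α` ∧ `χB_k(triv′)(U₀) ≠ 0`, under four SIZE ROWS on
`α₀ := c·ε₁(k+1)·L⁻²` — the two hypotheses of the SHARP SYMMETRIC PROP. 2 (`143·((d+4)²∕4)²·α₀ ≤ ⅓`, `2α₀ ≤ 2δ_{SU(2)}∕((d+4)L)²`), the window row `2α₀ < ε₁(k)` and the loop row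
`(((d+2)L)²∕4)·2α₀ < α`.  Proof: (i) regularity of `Ũ` = the DEFINITION of `chiMinAC` (`mem_chiMinAC_iff`, `UkH_triv`); (ii) ✓`BlockAveragingEMLProp2.plaqSmall_iter_blockAvg_eml_level`
([Balaban1985Averaging] Prop. 2 (52) ⇒ (54) for (0.4), uniform in `k`) ⇒ `|U₀(∂p) − 1| < 2α₀`; (iii) fibre: row r2 at the trivial history (`q.minRows.2.1`, `Ω_{k+1}(triv) = T` ✓`Omega_triv`),
its (40)-guard `ChargedT3` discharged from `ε₁(k+1) = θ(K−k−1) ≤ √L·θ(K−k) ≤ 2L²·awf(L)·θ(K−k)` (✓`T3SmallLiftHistory.sqrt_inv_mul_θBal_le_succ`); (iv) loops by ✓`LatticeWordStokes.dist1_loopHol_le`;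
(v) `χB_k(triv′)(U₀) = 1` by ✓`FibreClash.chiB_triv_eq`.  ★★ `hdeep_of_rows` ∕ ★★ `hdeep_loPrintAC_of_rows` = the loops-free letter «`∀ V ∈ lo (k+1), ∃ U₀, avgFun ℰp U₀ = V ∧ χB_k(triv′)(U₀) ≠ 0`»
in exactly the shape w8-19936 g16's (K-charge) knit consumes (bus 13:40:07Z), for `lo_c` and for print's `loPrintAC`.  At print's `c = 1` (`loPrintAC`) the size rows hold for every `L ≥ 2` once `γ` is small (`ε₁(k+1)∕ε₁(k) ≤ √L`); at
`c = max B₃ 1` they are the (E1) floor of evidence #57.  No estimate of [Balaban1985UV3] is asserted; the one analytic input is the tree's sharp Prop. 2.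

HONEST SCOPE.  [folklore] bookkeeping over landed theorems; def-free; nothing of (37)∕(47)∕(57), of row #23, of `hcharge`, of the (α) data rows (0∕23), of (O‴χₛ), `HistoryTailL`
(19936), EX, LOWB∘ or `YM3TorusSU2` is proved (rung R3 = SU(2) YM₃ on T³, a RECORD rung: NOT d = 4, NOT infinite volume, NOT a mass gap, NOT Clay; the Yang–Mills mass gap is NOT
proved).  L-floor: none (the family's `1 < L`).
References: T. Bałaban, Commun. Math. Phys. **102** (1985) 255–275 [Balaban1985UV3] ((4) p.256, (7) p.257, (40)–(42) p.266, (47) p.267, (49) p.268); Commun. Math. Phys. **98** (1985)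
17–51 [Balaban1985Averaging] (Prop. 2 (52)–(54) p.26); Commun. Math. Phys. **109** (1987) 249–301 [Balaban1987RG1] ((0.4) p.253).
-/

set_option autoImplicit false

noncomputable section

namespace Summit.QuantumFields.YangMills.Theorems

open MeasureTheory Literature.MathematicalPhysics.QuantumFieldTheory.Balaban1983to89
open Literature.MathematicalPhysics.QuantumFieldTheory.Balaban1983to89.BlockAveraging (avgFun loopHol Idx blockAvg)
open Literature.MathematicalPhysics.QuantumFieldTheory.Balaban1983to89.ExpMeanLog (expMeanLogSU deltaSU)
open Literature.MathematicalPhysics.QuantumFieldTheory.Balaban1983to89.T3ContinuumYM3Torus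
open Literature.MathematicalPhysics.QuantumFieldTheory.Balaban1983to89.T3UnitLawDensityEML (ℰp)
open Literature.MathematicalPhysics.QuantumFieldTheory.Balaban1983to89.T3UnitScaleTilt (θBal)
open Literature.MathematicalPhysics.QuantumFieldTheory.Balaban1983to89.B10Eq38TorusDomains (plaqsIn)
open Literature.MathematicalPhysics.QuantumFieldTheory.Balaban1983to89.B10Eq42TorusConstraint (bondsIn)
open Literature.MathematicalPhysics.QuantumFieldTheory.Balaban1985CMP102 Literature.MathematicalPhysics.QuantumFieldTheory.Balaban1985CMP102.Setting
open Summit.QuantumFields.Balaban3D.Carriers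
open Summit.QuantumFields.Balaban3D.Proofs.Primitives
open Summit.QuantumFields.Balaban3D.Proofs.TowerAC Summit.QuantumFields.Balaban3D.Proofs.StandardAC Summit.QuantumFields.Balaban3D.Proofs.InputsAC
open Summit.QuantumFields.Balaban3D.Proofs.Bound55Masses (chiB)
open scoped NNReal ENNReal

variable {F : T3Family} {𝔠 : AlphaConsts F.L (suGroupModel 2).N} {γ : ℝ} {hγ : 0 < γ} {hγ1 : γ ≤ (min 𝔠.gamma0 1) ^ 2} {K : ℕ}

namespace AlphaInputsT3AC.PkgCoreRows

variable (q : AlphaInputsT3AC.PkgCoreRows F 𝔠 γ hγ hγ1 K)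

/-- ★ **THE DEEP FIBRE POINT**: for `V` in the level-`(k+1)` (4)-window and in print's minimiser window `chiMinAC 𝔠.lane q.X c (k+1)`, the `k`-fold symmetric average
`U₀ := (blockAvg ℰp)^k U_{k+1}(V)` of the finest minimiser averages to `V` (row r2 at the trivial history), has every (0.4) loop variable within `α` of `1`, and lies in the
support of the trivial-history (58)-floor `χB_k` — given the four size rows on `α₀ := c·ε₁(k+1)·L⁻²` (sharp symmetric Prop. 2 ×2, `2α₀ < ε₁(k)`, `((d+2)L)²∕4·2α₀ < α`).  The letter
(L1) of the `hcharge` chain (19936 evidence «LOCATE-ALPHA-23-hcharge-supplier»). [cite: Balaban1985UV3, (47) p.267 + (42) p.266 + (49) p.268; Balaban1985Averaging, Prop. 2 (52)–(54) p.26] -/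
theorem deepFibrePoint_of_rows (k : ℕ) (hk : k + 1 ≤ K) {c α : ℝ} (hc : 0 < c)
    (hP3 : (143 * (((((F.P K).d + 4 : ℕ) : ℝ)) ^ 2 / 4) ^ 2) *
      (c * eps1Of (T3Scales F γ hγ (hγ1.trans (sq_min_one_le _ 𝔠.gamma0_pos)) K) 𝔠.lane.carrier (k + 1) * ((F.L : ℝ)⁻¹) ^ 2) ≤ 1 / 3)
    (hP2 : 2 * (c * eps1Of (T3Scales F γ hγ (hγ1.trans (sq_min_one_le _ 𝔠.gamma0_pos)) K) 𝔠.lane.carrier (k + 1) * ((F.L : ℝ)⁻¹) ^ 2) ≤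
      2 * deltaSU (Fin 2) / ((((F.P K).d + 4) * (F.P K).L : ℕ) : ℝ) ^ 2)
    (hwin : 2 * (c * eps1Of (T3Scales F γ hγ (hγ1.trans (sq_min_one_le _ 𝔠.gamma0_pos)) K) 𝔠.lane.carrier (k + 1) * ((F.L : ℝ)⁻¹) ^ 2) <
      eps1Of (T3Scales F γ hγ (hγ1.trans (sq_min_one_le _ 𝔠.gamma0_pos)) K) 𝔠.lane.carrier k)
    (hloop : ((((F.P K).d + 2) * (F.P K).L : ℕ) : ℝ) ^ 2 / 4 *
      (2 * (c * eps1Of (T3Scales F γ hγ (hγ1.trans (sq_min_one_le _ 𝔠.gamma0_pos)) K) 𝔠.lane.carrier (k + 1) * ((F.L : ℝ)⁻¹) ^ 2)) < α)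
    (V : GaugeField (F.P K) (k + 1) (Matrix.specialUnitaryGroup (Fin 2) ℂ))
    (hVw : PlaqSmall (eps1Of (T3Scales F γ hγ (hγ1.trans (sq_min_one_le _ 𝔠.gamma0_pos)) K) 𝔠.lane.carrier (k + 1)) V)
    (hVc : V ∈ PinnedStep.chiMinAC 𝔠.lane q.X c (k + 1)) :
    ∃ U₀ : GaugeField (F.P K) k (Matrix.specialUnitaryGroup (Fin 2) ℂ),
      avgFun (expMeanLogSU (n := Fin 2)) U₀ = V ∧ (∀ cc i, dist1 (loopHol U₀ cc i) < α) ∧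
      chiB 𝔠.lane.carrier.M₁ (rcolOf (T3Scales F γ hγ (hγ1.trans (sq_min_one_le _ 𝔠.gamma0_pos)) K) 𝔠.lane.carrier)
        (eps1Of (T3Scales F γ hγ (hγ1.trans (sq_min_one_le _ 𝔠.gamma0_pos)) K) 𝔠.lane.carrier) k (Hist.triv (F.P K) (k + 1)) U₀ ≠ 0 := by
  classical
  set S := T3Scales F γ hγ (hγ1.trans (sq_min_one_le _ 𝔠.gamma0_pos)) K with hS
  set ε1 : ℝ := eps1Of S 𝔠.lane.carrier (k + 1) with hε1
  set α₀ : ℝ := c * ε1 * ((F.L : ℝ)⁻¹) ^ 2 with hα₀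
  -- the finest minimiser of `V` and its `k`-fold average
  set Ut : GaugeField (F.P K) 0 (Matrix.specialUnitaryGroup (Fin 2) ℂ) := q.UkH (k + 1) (Hist.triv (F.P K) (k + 1)) V with hUt
  set U₀ : GaugeField (F.P K) k (Matrix.specialUnitaryGroup (Fin 2) ℂ) :=
    Averaging.iter (fun i => BlockAveraging.blockAvg (P := F.P K) (j := i) ℰp) k Ut with hU₀
  have hL1 : 1 ≤ F.L := by have := F.hL.2; omega
  have hLpos : (0 : ℝ) < F.L := by exact_mod_cast (by omega : 0 < F.L)
  have hε1pos : 0 < ε1 := by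
    have h := q.eps1_eq (k + 1) hk
    rw [hε1]
    have h' : eps1Of S 𝔠.lane.carrier (k + 1) = θBal F.L γ 𝔠.b₀ 𝔠.p₀ (K - (k + 1)) := h
    rw [h']; exact q.θBal_pos (k + 1) hk
  have hα₀pos : 0 < α₀ := by rw [hα₀]; positivity
  -- (1) regularity of the finest minimiser from print's χ (`chiMinAC` at constant `c`)
  have hreg : PlaqSmall (c * ε1 * ((F.L : ℝ)⁻¹) ^ (2 * (k + 1))) Ut := by
    have h := (PinnedStep.mem_chiMinAC_iff 𝔠.lane q.X c (k + 1) V).1 hVc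
    rw [← q.X.UkH_triv (k + 1) V] at h
    exact h
  have h52 : PlaqSmall (α₀ * ((((F.P K).L : ℝ) ^ k)⁻¹) ^ 2) Ut := by
    intro p
    refine (hreg p).trans_le (le_of_eq ?_)
    rw [hα₀]
    show c * ε1 * ((F.L : ℝ)⁻¹) ^ (2 * (k + 1)) = c * ε1 * ((F.L : ℝ)⁻¹) ^ 2 * ((((F.L : ℝ)) ^ k)⁻¹) ^ 2
    rw [← inv_pow, ← pow_mul, show 2 * (k + 1) = 2 + k * 2 by ring, pow_add]
    ring
  -- (2) the sharp symmetric Prop. 2 at level `k`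
  have havg := BlockAveragingEMLProp2.plaqSmall_iter_blockAvg_eml_level (P := F.P K) (n := Fin 2) k hα₀pos hP3 hP2 h52 (le_refl k)
  have hU₀small : PlaqSmall (2 * α₀) U₀ := by
    intro p
    have h := havg p
    have hLk : ((F.P K).L : ℝ) ^ k * (((F.P K).L : ℝ) ^ k)⁻¹ = 1 :=
      mul_inv_cancel₀ (pow_ne_zero _ (by exact_mod_cast (by omega : F.L ≠ 0)))
    rw [hLk, one_pow, mul_one] at h
    exact h
  refine ⟨U₀, ?_, fun cc i => ?_, ?_⟩
  · -- (3) the fibre: the `(k+1)`-fold average of the minimiser is `V` (row r2 at the trivial history, `Ω = T`)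
    have hCh : ChargedT3 F γ 𝔠.b₀ 𝔠.p₀ (avgWindowFactor F.L) K 𝔠.lane.carrier.M₁ (rcolOf S 𝔠.lane.carrier) (k + 1)
        (Hist.triv (F.P K) (k + 1)) V := by
      refine ⟨Hist.admissible_triv _ _ _, fun p _ => (hVw p).trans_le ?_⟩
      -- `ε₁(k+1) = θ(K−k−1) ≤ √L·θ(K−k) ≤ 2L²·awf(L)·θ(K−(k+1)+1)`
      have hidx : K - (k + 1) + 1 = K - k := by omega
      rw [hidx]
      have heps : ε1 = θBal F.L γ 𝔠.b₀ 𝔠.p₀ (K - (k + 1)) := by rw [hε1]; exact q.eps1_eq (k + 1) hk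
      rw [heps]
      have hγ1' : γ ≤ 1 := hγ1.trans (sq_min_one_le _ 𝔠.gamma0_pos)
      have hstep := T3SmallLiftHistory.sqrt_inv_mul_θBal_le_succ (L := F.L) (γ := γ) (b₀ := 𝔠.b₀) (p₀ := 𝔠.p₀)
        hL1 hγ hγ1' 𝔠.b₀_pos.le 𝔠.p₀_pos.le (K - (k + 1))
      have hidx' : K - (k + 1) + 1 = K - k := by omega
      rw [hidx'] at hstep
      have hθpos : 0 ≤ θBal F.L γ 𝔠.b₀ 𝔠.p₀ (K - k) := (q.θBal_pos k (by omega)).le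
      have hsq : 0 < Real.sqrt ((F.L : ℝ)⁻¹) := Real.sqrt_pos.2 (inv_pos.2 hLpos)
      -- `θ(K−k−1) ≤ θ(K−k)/√(L⁻¹)` and `1/√(L⁻¹) = √L ≤ L ≤ 2L²·awf(L)`
      have h1 : θBal F.L γ 𝔠.b₀ 𝔠.p₀ (K - (k + 1)) ≤ (Real.sqrt ((F.L : ℝ)⁻¹))⁻¹ * θBal F.L γ 𝔠.b₀ 𝔠.p₀ (K - k) := by
        rw [le_inv_mul_iff₀ hsq]; exact hstep
      refine h1.trans (mul_le_mul_of_nonneg_right ?_ hθpos)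
      have hawf : 1 ≤ avgWindowFactor F.L := by
        unfold avgWindowFactor
        have : (1 : ℝ) ≤ (F.L : ℝ) ^ 2 := by nlinarith [show (1:ℝ) ≤ F.L by exact_mod_cast hL1]
        nlinarith [sq_nonneg ((((3 + 2) * F.L : ℕ) : ℝ))]
      have hsqrt_le : (Real.sqrt ((F.L : ℝ)⁻¹))⁻¹ ≤ (F.L : ℝ) := by
        rw [Real.sqrt_inv, inv_inv]
        calc Real.sqrt (F.L : ℝ) ≤ Real.sqrt ((F.L : ℝ) ^ 2) :=
              Real.sqrt_le_sqrt (by nlinarith [show (1:ℝ) ≤ F.L by exact_mod_cast hL1])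
          _ = (F.L : ℝ) := Real.sqrt_sq hLpos.le
      calc (Real.sqrt ((F.L : ℝ)⁻¹))⁻¹ ≤ (F.L : ℝ) := hsqrt_le
        _ ≤ 2 * (F.L : ℝ) ^ 2 * 1 := by nlinarith [show (1:ℝ) ≤ F.L by exact_mod_cast hL1]
        _ ≤ 2 * (F.L : ℝ) ^ 2 * avgWindowFactor F.L := by gcongr
    have hfib := q.minRows.2.1 (k + 1) hk (Hist.triv (F.P K) (k + 1)) V hCh
    funext b
    have hb : b ∈ bondsIn (k + 1) (Omega 𝔠.lane.carrier.M₁ (rcolOf S 𝔠.lane.carrier) (k + 1) (Hist.triv (F.P K) (k + 1)) (k + 1)) := by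
      rw [Omega_triv]; exact ⟨Set.mem_univ _, Set.mem_univ _⟩
    exact hfib b hb
  · -- (4) the loop variables of `U₀`
    have h := LatticeWordStokes.dist1_loopHol_le (P := F.P K) (by positivity : (0:ℝ) ≤ 2 * α₀) hU₀small cc i
    exact h.trans_lt hloop
  · -- (5) `U₀` is inside the level-`k` (4)-window, so `χB_k(triv′)(U₀) = 1`
    have hall : PlaqSmall (eps1Of S 𝔠.lane.carrier k) U₀ := fun p => (hU₀small p).trans hwin
    have h1 := Summit.QuantumFields.Balaban3D.Proofs.FibreClash.chiB_triv_eq (S := S) (k := k) 𝔠.lane.carrier.M₁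
      (rcolOf S 𝔠.lane.carrier) (eps1Of S 𝔠.lane.carrier) U₀
    have h2 : chiB 𝔠.lane.carrier.M₁ (rcolOf S 𝔠.lane.carrier) (eps1Of S 𝔠.lane.carrier) k (Hist.triv (F.P K) (k + 1)) U₀ = 1 :=
      h1.trans (if_pos hall)
    rw [h2]
    exact one_ne_zero

/-- ★★ **THE LETTER `hdeep` OF w8-19936 g16's (K-charge) KNIT, ON THE CONSTANT-`c` FAMILY**: every `V ∈ {(4)-window (k+1)} ∩ chiMinAC 𝔠.lane q.X c (k+1)` has a one-step fibre point
`U₀` (`avgFun ℰp U₀ = V`) in the support of the trivial-history (58)-floor `χB_k` — `deepFibrePoint_of_rows` with the loop conjunct dropped (three size rows: sharp Prop. 2 ×2 and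
`2α₀ < ε₁(k)`, `α₀ := c·ε₁(k+1)·L⁻²`). [cite: Balaban1985UV3, (47) p.267 + (42) p.266 + (49) p.268; Balaban1985Averaging, Prop. 2 (52)–(54) p.26] -/
theorem hdeep_of_rows (k : ℕ) (hk : k + 1 ≤ K) {c : ℝ} (hc : 0 < c)
    (hP3 : (143 * (((((F.P K).d + 4 : ℕ) : ℝ)) ^ 2 / 4) ^ 2) *
      (c * eps1Of (T3Scales F γ hγ (hγ1.trans (sq_min_one_le _ 𝔠.gamma0_pos)) K) 𝔠.lane.carrier (k + 1) * ((F.L : ℝ)⁻¹) ^ 2) ≤ 1 / 3)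
    (hP2 : 2 * (c * eps1Of (T3Scales F γ hγ (hγ1.trans (sq_min_one_le _ 𝔠.gamma0_pos)) K) 𝔠.lane.carrier (k + 1) * ((F.L : ℝ)⁻¹) ^ 2) ≤
      2 * deltaSU (Fin 2) / ((((F.P K).d + 4) * (F.P K).L : ℕ) : ℝ) ^ 2)
    (hwin : 2 * (c * eps1Of (T3Scales F γ hγ (hγ1.trans (sq_min_one_le _ 𝔠.gamma0_pos)) K) 𝔠.lane.carrier (k + 1) * ((F.L : ℝ)⁻¹) ^ 2) < eps1Of (T3Scales F γ hγ (hγ1.trans (sq_min_one_le _ 𝔠.gamma0_pos)) K) 𝔠.lane.carrier k) :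
    ∀ V ∈ {V : GaugeField (F.P K) (k + 1) (Matrix.specialUnitaryGroup (Fin 2) ℂ) | PlaqSmall (eps1Of (T3Scales F γ hγ (hγ1.trans (sq_min_one_le _ 𝔠.gamma0_pos)) K) 𝔠.lane.carrier (k + 1)) V} ∩
        PinnedStep.chiMinAC 𝔠.lane q.X c (k + 1),
      ∃ U₀ : GaugeField (F.P K) k (Matrix.specialUnitaryGroup (Fin 2) ℂ), avgFun (expMeanLogSU (n := Fin 2)) U₀ = V ∧
        chiB 𝔠.lane.carrier.M₁ (rcolOf (T3Scales F γ hγ (hγ1.trans (sq_min_one_le _ 𝔠.gamma0_pos)) K) 𝔠.lane.carrier) (eps1Of (T3Scales F γ hγ (hγ1.trans (sq_min_one_le _ 𝔠.gamma0_pos)) K) 𝔠.lane.carrier) k (Hist.triv (F.P K) (k + 1)) U₀ ≠ 0 := by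
  intro V hV
  obtain ⟨U₀, h1, -, h3⟩ := q.deepFibrePoint_of_rows k hk hc hP3 hP2 hwin
    (lt_add_one (((((F.P K).d + 2) * (F.P K).L : ℕ) : ℝ) ^ 2 / 4 * (2 * (c * eps1Of (T3Scales F γ hγ (hγ1.trans (sq_min_one_le _ 𝔠.gamma0_pos)) K) 𝔠.lane.carrier (k + 1) * ((F.L : ℝ)⁻¹) ^ 2))))
    V hV.1 hV.2
  exact ⟨U₀, h1, h3⟩

/-- ★★ **THE SAME ON PRINT'S FAMILY `loPrintAC` (`c = 1`)**: every `V ∈ loPrintAC 𝔠.lane q.X (k+1)` ([Balaban1985UV3] (47) p.267: the (4)-window ∧ «|U_{k+1}(∂p) − 1| < g_{k+1}p(g_{k+1})η²»)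
has a one-step fibre point in the support of `χB_k(triv′)`, under the three size rows at `α₀ := ε₁(k+1)·L⁻²` (which hold on the γ-window for every `L ≥ 2`: `ε₁(k+1)∕ε₁(k) ≤ √L`).
[cite: Balaban1985UV3, (47) p.267 + (42) p.266 + (49) p.268; Balaban1985Averaging, Prop. 2 (52)–(54) p.26] -/
theorem hdeep_loPrintAC_of_rows (k : ℕ) (hk : k + 1 ≤ K)
    (hP3 : (143 * (((((F.P K).d + 4 : ℕ) : ℝ)) ^ 2 / 4) ^ 2) *
      (1 * eps1Of (T3Scales F γ hγ (hγ1.trans (sq_min_one_le _ 𝔠.gamma0_pos)) K) 𝔠.lane.carrier (k + 1) * ((F.L : ℝ)⁻¹) ^ 2) ≤ 1 / 3)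
    (hP2 : 2 * (1 * eps1Of (T3Scales F γ hγ (hγ1.trans (sq_min_one_le _ 𝔠.gamma0_pos)) K) 𝔠.lane.carrier (k + 1) * ((F.L : ℝ)⁻¹) ^ 2) ≤
      2 * deltaSU (Fin 2) / ((((F.P K).d + 4) * (F.P K).L : ℕ) : ℝ) ^ 2)
    (hwin : 2 * (1 * eps1Of (T3Scales F γ hγ (hγ1.trans (sq_min_one_le _ 𝔠.gamma0_pos)) K) 𝔠.lane.carrier (k + 1) * ((F.L : ℝ)⁻¹) ^ 2) < eps1Of (T3Scales F γ hγ (hγ1.trans (sq_min_one_le _ 𝔠.gamma0_pos)) K) 𝔠.lane.carrier k) :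
    ∀ V ∈ PinnedStep.loPrintAC 𝔠.lane q.X (k + 1),
      ∃ U₀ : GaugeField (F.P K) k (Matrix.specialUnitaryGroup (Fin 2) ℂ), avgFun (expMeanLogSU (n := Fin 2)) U₀ = V ∧
        chiB 𝔠.lane.carrier.M₁ (rcolOf (T3Scales F γ hγ (hγ1.trans (sq_min_one_le _ 𝔠.gamma0_pos)) K) 𝔠.lane.carrier) (eps1Of (T3Scales F γ hγ (hγ1.trans (sq_min_one_le _ 𝔠.gamma0_pos)) K) 𝔠.lane.carrier) k (Hist.triv (F.P K) (k + 1)) U₀ ≠ 0 :=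
  fun V hV => q.hdeep_of_rows k hk one_pos hP3 hP2 hwin V ⟨hV.1, hV.2⟩

/-- ★★ **THE FAMILY FORM WITH LOOPS** — `deepFibrePoint_of_rows` read as «`∀ V ∈ {(4)-window (k+1)} ∩ chiMinAC 𝔠.lane q.X c (k+1), ∃ U₀, Ū U₀ = V ∧ loops < α ∧ χB ≠ 0`», the `hdeep`
binder of ✓`AvgFunLocalLowerDensity.charge_of_deepFibrePoints` (w8-19936 g16) at `L := lo_c (k+1)`, `ε := α`. [cite: Balaban1985UV3, (47) p.267 + (42) p.266 + (49) p.268] -/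
theorem hdeepLoops_of_rows (k : ℕ) (hk : k + 1 ≤ K) {c α : ℝ} (hc : 0 < c)
    (hP3 : (143 * (((((F.P K).d + 4 : ℕ) : ℝ)) ^ 2 / 4) ^ 2) *
      (c * eps1Of (T3Scales F γ hγ (hγ1.trans (sq_min_one_le _ 𝔠.gamma0_pos)) K) 𝔠.lane.carrier (k + 1) * ((F.L : ℝ)⁻¹) ^ 2) ≤ 1 / 3)
    (hP2 : 2 * (c * eps1Of (T3Scales F γ hγ (hγ1.trans (sq_min_one_le _ 𝔠.gamma0_pos)) K) 𝔠.lane.carrier (k + 1) * ((F.L : ℝ)⁻¹) ^ 2) ≤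
      2 * deltaSU (Fin 2) / ((((F.P K).d + 4) * (F.P K).L : ℕ) : ℝ) ^ 2)
    (hwin : 2 * (c * eps1Of (T3Scales F γ hγ (hγ1.trans (sq_min_one_le _ 𝔠.gamma0_pos)) K) 𝔠.lane.carrier (k + 1) * ((F.L : ℝ)⁻¹) ^ 2) < eps1Of (T3Scales F γ hγ (hγ1.trans (sq_min_one_le _ 𝔠.gamma0_pos)) K) 𝔠.lane.carrier k)
    (hloop : ((((F.P K).d + 2) * (F.P K).L : ℕ) : ℝ) ^ 2 / 4 *
      (2 * (c * eps1Of (T3Scales F γ hγ (hγ1.trans (sq_min_one_le _ 𝔠.gamma0_pos)) K) 𝔠.lane.carrier (k + 1) * ((F.L : ℝ)⁻¹) ^ 2)) < α) :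
    ∀ V ∈ {V : GaugeField (F.P K) (k + 1) (Matrix.specialUnitaryGroup (Fin 2) ℂ) | PlaqSmall (eps1Of (T3Scales F γ hγ (hγ1.trans (sq_min_one_le _ 𝔠.gamma0_pos)) K) 𝔠.lane.carrier (k + 1)) V} ∩
        PinnedStep.chiMinAC 𝔠.lane q.X c (k + 1),
      ∃ U₀ : GaugeField (F.P K) k (Matrix.specialUnitaryGroup (Fin 2) ℂ), avgFun (expMeanLogSU (n := Fin 2)) U₀ = V ∧
        (∀ cc i, dist1 (loopHol U₀ cc i) < α) ∧
        chiB 𝔠.lane.carrier.M₁ (rcolOf (T3Scales F γ hγ (hγ1.trans (sq_min_one_le _ 𝔠.gamma0_pos)) K) 𝔠.lane.carrier) (eps1Of (T3Scales F γ hγ (hγ1.trans (sq_min_one_le _ 𝔠.gamma0_pos)) K) 𝔠.lane.carrier) k (Hist.triv (F.P K) (k + 1)) U₀ ≠ 0 :=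
  fun V hV => q.deepFibrePoint_of_rows k hk hc hP3 hP2 hwin hloop V hV.1 hV.2

end AlphaInputsT3AC.PkgCoreRows

end Summit.QuantumFields.YangMills.Theorems

end
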